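import Literature.NumberTheory.Automorphic.UnitaryGroupCovolWeightStable            -- ★ §0 lattice-side facts for ANY `γ` (countable ∕ discrete ∕ `count` Haar), ★ (b2), ★ `LatticeCovolumeTransport`
import Literature.NumberTheory.Automorphic.UnitaryGroupOrbitalMeasureOfLocalQuotient   -- ★ `isHaarMeasure_map_subgroupCongrHomeomorph`, `isInvInvariant_map_subgroupCongrHomeomorph`, `isMulRightInvariant_map_mulEquiv_of_isMulRightInvariant`
import Literature.MeasureTheory.Group.InvariantQuotientOrbitalTransport                 -- ★ `forall_apply_mem_centralizer_singleton_iff_of_eq`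
import Literature.MeasureTheory.Group.LatticeCovolumeTransport                          -- ★ `covolume_count_eq_of_mulEquiv'`
import HarnessLib

/-!
# The centraliser covolume `m(Z_γ(L⁺) ∖ Z_γ(𝔸))` is invariant under a RATIONAL change of basis `γ₀ ↦ g γ₀ g⁻¹ : U(H₀)(L⁺) → U(H)(L⁺)`, `ᵗ(c g)·H·g = H₀` — for EVERY `γ₀`, regular or not
(Rogawski 1990 §3.8 Prop. 3.8.1 p. 27, §14.5 pp. 237–239 «m(Z G′_{γ} ∖ G′_{γ})»; Gelbart 1975 Remark 9.23; Platonov–Rapinchuk 1994 §2.3)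

Topic `NumberTheory/Automorphic`; namespace `Literature.NumberTheory.Automorphic.UnitaryGroup`.  THEOREMS ONLY (no definition, no instance, no notation, no `sorry`).
Cell `pub/hodgecm-mathlib`, crux H413 = `stmt-HodgeConjecture-24833` (supports-only, count-neutral); LH5-p01 (g4), the memo (M-Z1)'s assembly step (3)–(4) «GLOBAL CONGRUENCE
restricted to centralisers + COVOLUME NATURALITY» as a road-independent brick.  ★ (b2) `covolume_eq_of_map_adelicStableCentralizerEquiv_eq` does this for REGULAR `γ` along the
canonical stable-centraliser isomorphism (any conjugator; needs a commutative commutant); for a SINGULAR rational `γ₀` (the Z1 ∕ X1 towers of the LH5 line) the centraliser is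
non-abelian and one must transport along an honest isomorphism of the ambient adelic groups — the congruence ★ `adelicUnitaryGroupCongr L g H H₀ hg : U(H₀)(𝔸) ≃ₜ* U(H)(𝔸)`,
`x ↦ g_𝔸 x g_𝔸⁻¹`, of a rational frame `g ∈ GL_N(L)` (★ `exists_singular_frame_of_anisotropic`).  HONEST LABEL: kit; HC_CM is proved only modulo the 7 printed citations
(2 remaining: hLiu418 = stmt-HodgeConjecture-24832, h413 = stmt-HodgeConjecture-24833) until rung 0 closes.

* §1 `adelicUnitaryGroupCongr_toAdelic` (`E(γ₀ ⊗ 1) = γ ⊗ 1` when `g γ₀ g⁻¹ = γ`), `adelicUnitaryGroupCongr_mem_quotientSubgroup_iff` (`E` carries `U(H₀)(L⁺)` onto `U(H)(L⁺)`),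
  and both read on the `cmDatum` carriers with `E` bound as data (`congr_toAdelic_eq`, `congr_mem_quotientSubgroup_iff` — the spelling of the LH5 towers' frames).
* §2 `isHaarMeasure_map_subgroupCongrHomeomorph_congr`, `isMulRightInvariant_map_subgroupCongrHomeomorph_congr`, `isInvInvariant_map_subgroupCongrHomeomorph_congr` — the tower
  `tA₀` on `Z(γ₀ ⊗ 1)` pushed along `E|` keeps Z1's three instance clauses.
* §3 HEAD **`covolume_map_subgroupCongrHomeomorph_congr_eq`**: `quotientMeasure (U(H₀)(L⁺)_{γ₀} ≤ Z(γ₀⊗1)) count tA₀ ⊤ = quotientMeasure (U(H)(L⁺)_γ ≤ Z(γ⊗1)) count ((E|)_* tA₀) ⊤`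
  (★ `covolume_count_eq_of_mulEquiv'`; the lattice-side instance binders discharged as in ★ (b2)′).

## References
* [Rogawski1990] J. D. Rogawski, *Automorphic Representations of Unitary Groups in Three Variables*, Ann. of Math. Stud. 123 (1990), §3.8 Prop. 3.8.1 p. 27; §14.5 pp. 237–239.
* [Gelbart1975] S. Gelbart, *Automorphic forms on adele groups*, Ann. of Math. Studies 83 (1975), Remark 9.23.
* [PlatonovRapinchuk1994] V. Platonov, A. Rapinchuk, *Algebraic Groups and Number Theory* (1994), §2.3.
-/

set_option autoImplicit false

noncomputable section

open MeasureTheory Measure NumberField IsDedekindDomain Topology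
open Literature.MeasureTheory.Group
open Literature.AlgebraicGeometry.ShimuraVarieties (unitaryGroup)
open scoped Matrix MatrixGroups ENNReal NNReal

namespace Literature.NumberTheory.Automorphic

namespace UnitaryGroup

section Congr

variable (L : Type) [Field L] [NumberField L] [IsCMField L] {N : ℕ} {H H₀ : Matrix (Fin N) (Fin N) L}
  (g : GL (Fin N) L) (hg : (((g : Matrix (Fin N) (Fin N) L)).map (cmConjRingHom L))ᵀ * H * (g : Matrix (Fin N) (Fin N) L) = H₀)

/-! ## §1 The congruence on rational points -/

/-- **`E (γ₀ ⊗ 1) = γ ⊗ 1`** for `E = adelicUnitaryGroupCongr L g H H₀ hg` and rational `γ₀ ∈ U(H₀)(L⁺)`, `γ ∈ U(H)(L⁺)` with `g γ₀ g⁻¹ = γ`.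
[cite: Rogawski1990, §3.8 Prop. 3.8.1 p. 27] [cite: PlatonovRapinchuk1994, §2.3] -/
theorem adelicUnitaryGroupCongr_toAdelic (γ₀ : (cmDatum L N H₀).Rational) (γ : (cmDatum L N H).Rational)
    (hγ : g * (γ₀.val : GL (Fin N) L) * g⁻¹ = γ.val) :
    adelicUnitaryGroupCongr L g H H₀ hg ((cmDatum L N H₀).toAdelic γ₀) = (cmDatum L N H).toAdelic γ := by
  apply Subtype.ext
  rw [coe_adelicUnitaryGroupCongr, coe_cmDatum_toAdelic, coe_cmDatum_toAdelic, ← hγ, map_mul, map_mul, map_inv]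

/-- **`E` carries `U(H₀)(L⁺)` onto `U(H)(L⁺)`**: `E z ∈ A_G·U(H)(L⁺) ↔ z ∈ A_G·U(H₀)(L⁺)` (`A_G = 1` for `cmDatum`; ★ `adelicUnitaryGroupCongr_mem_rat` both ways).
[cite: Rogawski1990, §14.5 p. 238] [cite: PlatonovRapinchuk1994, §2.3] -/
theorem adelicUnitaryGroupCongr_mem_quotientSubgroup_iff (z : (cmDatum L N H₀).Adelic) :
    adelicUnitaryGroupCongr L g H H₀ hg z ∈ (cmDatum L N H).quotientSubgroup ↔ z ∈ (cmDatum L N H₀).quotientSubgroup := by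
  rw [cmDatum_quotientSubgroup, cmDatum_quotientSubgroup]
  refine ⟨fun h => ?_, fun h => adelicUnitaryGroupCongr_mem_rat L g H H₀ hg h⟩
  obtain ⟨x, hx, hxe⟩ := (mem_adelicUnitaryRat_iff L H _).1 h
  refine (mem_adelicUnitaryRat_iff L H₀ _).2 ⟨g⁻¹ * x * g, ?_, ?_⟩
  · have h' := conj_mem_unitaryGroup_of_congr (cmConjRingHom L) g⁻¹ H₀ H (matrix_congr_inv (cmConjRingHom L) g H H₀ hg) hx
    rwa [inv_inv] at h'
  · rw [map_mul, map_mul, map_inv, hxe, coe_adelicUnitaryGroupCongr]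
    group

/-- The same for the congruence READ ON THE `cmDatum` CARRIERS (`E = adelicUnitaryGroupCongr …` bound as data with its equation, the spelling the LH5 towers use):
`E (γ₀ ⊗ 1) = γ ⊗ 1`. [cite: Rogawski1990, §3.8 Prop. 3.8.1 p. 27] -/
theorem congr_toAdelic_eq (E : (cmDatum L N H₀).Adelic ≃ₜ* (cmDatum L N H).Adelic) (hE : E = adelicUnitaryGroupCongr L g H H₀ hg)
    (γ₀ : (cmDatum L N H₀).Rational) (γ : (cmDatum L N H).Rational) (hγ : g * (γ₀.val : GL (Fin N) L) * g⁻¹ = γ.val) :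
    E ((cmDatum L N H₀).toAdelic γ₀) = (cmDatum L N H).toAdelic γ := by
  subst hE
  exact adelicUnitaryGroupCongr_toAdelic L g hg γ₀ γ hγ

/-- `E` carries the lattice onto the lattice, on the `cmDatum` carriers. [cite: Rogawski1990, §14.5 p. 238] -/
theorem congr_mem_quotientSubgroup_iff (E : (cmDatum L N H₀).Adelic ≃ₜ* (cmDatum L N H).Adelic) (hE : E = adelicUnitaryGroupCongr L g H H₀ hg)
    (z : (cmDatum L N H₀).Adelic) : E z ∈ (cmDatum L N H).quotientSubgroup ↔ z ∈ (cmDatum L N H₀).quotientSubgroup := by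
  subst hE
  exact adelicUnitaryGroupCongr_mem_quotientSubgroup_iff L g hg z

end Congr

/-! ## §2 The transported tower keeps Z1's instance clauses -/

section Tower

variable (L : Type) [Field L] [NumberField L] [IsCMField L] {N : ℕ} {H H₀ : Matrix (Fin N) (Fin N) L}
  (g : GL (Fin N) L) (hg : (((g : Matrix (Fin N) (Fin N) L)).map (cmConjRingHom L))ᵀ * H * (g : Matrix (Fin N) (Fin N) L) = H₀)
  (E : (cmDatum L N H₀).Adelic ≃ₜ* (cmDatum L N H).Adelic) (hE : E = adelicUnitaryGroupCongr L g H H₀ hg)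
  [MeasurableSpace (cmDatum L N H₀).Adelic] [BorelSpace (cmDatum L N H₀).Adelic] [MeasurableSpace (cmDatum L N H).Adelic] [BorelSpace (cmDatum L N H).Adelic]
  (γ₀ : (cmDatum L N H₀).Rational) (γ : (cmDatum L N H).Rational) (hγ : g * (γ₀.val : GL (Fin N) L) * g⁻¹ = γ.val)

/-- The pushed-forward tower `(E|)_* tA₀` on `Z(γ ⊗ 1)` is a Haar measure (`Z(γ₀ ⊗ 1)` closed in the locally compact `U(H₀)(𝔸)`). [cite: Rogawski1990, §14.5 p. 238] -/
theorem isHaarMeasure_map_subgroupCongrHomeomorph_congr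
    (hZ₀ : IsClosed ((Subgroup.centralizer ({(cmDatum L N H₀).toAdelic γ₀} : Set (cmDatum L N H₀).Adelic) : Subgroup (cmDatum L N H₀).Adelic) : Set (cmDatum L N H₀).Adelic))
    (tA₀ : Measure ↥(Subgroup.centralizer ({(cmDatum L N H₀).toAdelic γ₀} : Set (cmDatum L N H₀).Adelic))) [IsHaarMeasure tA₀] :
    IsHaarMeasure (Measure.map (subgroupCongrHomeomorph E.toMulEquiv
      (Subgroup.centralizer ({(cmDatum L N H₀).toAdelic γ₀} : Set (cmDatum L N H₀).Adelic)) (Subgroup.centralizer ({(cmDatum L N H).toAdelic γ} : Set (cmDatum L N H).Adelic))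
      (forall_apply_mem_centralizer_singleton_iff_of_eq E.toMulEquiv (congr_toAdelic_eq L g hg E hE γ₀ γ hγ))
      E.continuous E.symm.continuous) tA₀) := by
  haveI : LocallyCompactSpace ↥(Subgroup.centralizer ({(cmDatum L N H₀).toAdelic γ₀} : Set (cmDatum L N H₀).Adelic)) := hZ₀.isClosedEmbedding_subtypeVal.locallyCompactSpace
  exact isHaarMeasure_map_subgroupCongrHomeomorph _ _ _ _ _ _ tA₀

/-- The pushed-forward tower is right invariant when `tA₀` is. [cite: Rogawski1990, §14.5 p. 238] -/
theorem isMulRightInvariant_map_subgroupCongrHomeomorph_congr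
    (tA₀ : Measure ↥(Subgroup.centralizer ({(cmDatum L N H₀).toAdelic γ₀} : Set (cmDatum L N H₀).Adelic))) [tA₀.IsMulRightInvariant] :
    (Measure.map (subgroupCongrHomeomorph E.toMulEquiv
      (Subgroup.centralizer ({(cmDatum L N H₀).toAdelic γ₀} : Set (cmDatum L N H₀).Adelic)) (Subgroup.centralizer ({(cmDatum L N H).toAdelic γ} : Set (cmDatum L N H).Adelic))
      (forall_apply_mem_centralizer_singleton_iff_of_eq E.toMulEquiv (congr_toAdelic_eq L g hg E hE γ₀ γ hγ))
      E.continuous E.symm.continuous) tA₀).IsMulRightInvariant := by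
  set eH := subgroupCongrHomeomorph E.toMulEquiv
      (Subgroup.centralizer ({(cmDatum L N H₀).toAdelic γ₀} : Set (cmDatum L N H₀).Adelic)) (Subgroup.centralizer ({(cmDatum L N H).toAdelic γ} : Set (cmDatum L N H).Adelic))
      (forall_apply_mem_centralizer_singleton_iff_of_eq E.toMulEquiv (congr_toAdelic_eq L g hg E hE γ₀ γ hγ))
      E.continuous E.symm.continuous with heH
  let f : ↥(Subgroup.centralizer ({(cmDatum L N H₀).toAdelic γ₀} : Set (cmDatum L N H₀).Adelic)) ≃* ↥(Subgroup.centralizer ({(cmDatum L N H).toAdelic γ} : Set (cmDatum L N H).Adelic)) :=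
    { toEquiv := eH.toEquiv
      map_mul' := fun a b => Subtype.ext (map_mul E.toMulEquiv (a : (cmDatum L N H₀).Adelic) (b : (cmDatum L N H₀).Adelic)) }
  have hf : (f : _ → _) = eH := rfl
  have h := isMulRightInvariant_map_mulEquiv_of_isMulRightInvariant f (hf ▸ eH.continuous.measurable) tA₀
  rwa [hf] at h

/-- The pushed-forward tower is inversion invariant when `tA₀` is. [cite: Rogawski1990, §14.5 p. 238] -/
theorem isInvInvariant_map_subgroupCongrHomeomorph_congr
    (tA₀ : Measure ↥(Subgroup.centralizer ({(cmDatum L N H₀).toAdelic γ₀} : Set (cmDatum L N H₀).Adelic))) [tA₀.IsInvInvariant] :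
    (Measure.map (subgroupCongrHomeomorph E.toMulEquiv
      (Subgroup.centralizer ({(cmDatum L N H₀).toAdelic γ₀} : Set (cmDatum L N H₀).Adelic)) (Subgroup.centralizer ({(cmDatum L N H).toAdelic γ} : Set (cmDatum L N H).Adelic))
      (forall_apply_mem_centralizer_singleton_iff_of_eq E.toMulEquiv (congr_toAdelic_eq L g hg E hE γ₀ γ hγ))
      E.continuous E.symm.continuous) tA₀).IsInvInvariant :=
  isInvInvariant_map_subgroupCongrHomeomorph _ _ _ _ _ _ tA₀

/-! ## §3 The covolume is transported -/

set_option maxHeartbeats 800000 in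
/-- **THE CENTRALISER COVOLUME IS INVARIANT UNDER A RATIONAL CONGRUENCE, FOR EVERY `γ₀`**: with `E = adelicUnitaryGroupCongr L g H H₀ hg` (`g ∈ GL_N(L)`, `ᵗ(c g)·H·g = H₀`),
`g γ₀ g⁻¹ = γ`, and any Haar, right-invariant tower `tA₀` on `Z(γ₀ ⊗ 1) ≤ U(H₀)(𝔸)`:
`m(U(H₀)(L⁺)_{γ₀} ∖ Z(γ₀ ⊗ 1); tA₀) = m(U(H)(L⁺)_γ ∖ Z(γ ⊗ 1); (E|)_* tA₀)` (counting measure on the lattices, Weil constant one — the currency of the (T′) ∕ Z1 letters).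
`E|` carries the lattice onto the lattice (§1) and `count` to `count`; ★ `covolume_count_eq_of_mulEquiv'`.  No regularity of `γ₀` is needed (contrast ★ (b2)).  The two instance
binders on `(E|)_* tA₀` are supplied by §2 (`isHaarMeasure_…_congr`, `isMulRightInvariant_…_congr`) at the call site.
[cite: Rogawski1990, §14.5 pp. 237–239] [cite: Gelbart1975, Remark 9.23] [cite: PlatonovRapinchuk1994, §2.3] -/
theorem covolume_map_subgroupCongrHomeomorph_congr_eq
    (hZ₀ : IsClosed ((Subgroup.centralizer ({(cmDatum L N H₀).toAdelic γ₀} : Set (cmDatum L N H₀).Adelic) : Subgroup (cmDatum L N H₀).Adelic) : Set (cmDatum L N H₀).Adelic))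
    (hZ : IsClosed ((Subgroup.centralizer ({(cmDatum L N H).toAdelic γ} : Set (cmDatum L N H).Adelic) : Subgroup (cmDatum L N H).Adelic) : Set (cmDatum L N H).Adelic))
    [MeasurableSpace (↥(Subgroup.centralizer ({(cmDatum L N H₀).toAdelic γ₀} : Set (cmDatum L N H₀).Adelic)) ⧸
      ((cmDatum L N H₀).quotientSubgroup ⊓ Subgroup.centralizer ({(cmDatum L N H₀).toAdelic γ₀} : Set (cmDatum L N H₀).Adelic)).subgroupOf
        (Subgroup.centralizer ({(cmDatum L N H₀).toAdelic γ₀} : Set (cmDatum L N H₀).Adelic)))]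
    [BorelSpace (↥(Subgroup.centralizer ({(cmDatum L N H₀).toAdelic γ₀} : Set (cmDatum L N H₀).Adelic)) ⧸
      ((cmDatum L N H₀).quotientSubgroup ⊓ Subgroup.centralizer ({(cmDatum L N H₀).toAdelic γ₀} : Set (cmDatum L N H₀).Adelic)).subgroupOf
        (Subgroup.centralizer ({(cmDatum L N H₀).toAdelic γ₀} : Set (cmDatum L N H₀).Adelic)))]
    [MeasurableSpace (↥(Subgroup.centralizer ({(cmDatum L N H).toAdelic γ} : Set (cmDatum L N H).Adelic)) ⧸
      ((cmDatum L N H).quotientSubgroup ⊓ Subgroup.centralizer ({(cmDatum L N H).toAdelic γ} : Set (cmDatum L N H).Adelic)).subgroupOf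
        (Subgroup.centralizer ({(cmDatum L N H).toAdelic γ} : Set (cmDatum L N H).Adelic)))]
    [BorelSpace (↥(Subgroup.centralizer ({(cmDatum L N H).toAdelic γ} : Set (cmDatum L N H).Adelic)) ⧸
      ((cmDatum L N H).quotientSubgroup ⊓ Subgroup.centralizer ({(cmDatum L N H).toAdelic γ} : Set (cmDatum L N H).Adelic)).subgroupOf
        (Subgroup.centralizer ({(cmDatum L N H).toAdelic γ} : Set (cmDatum L N H).Adelic)))]
    [(count : Measure ↥(((cmDatum L N H₀).quotientSubgroup ⊓ Subgroup.centralizer ({(cmDatum L N H₀).toAdelic γ₀} : Set (cmDatum L N H₀).Adelic)).subgroupOf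
        (Subgroup.centralizer ({(cmDatum L N H₀).toAdelic γ₀} : Set (cmDatum L N H₀).Adelic)))).IsHaarMeasure]
    [(count : Measure ↥(((cmDatum L N H).quotientSubgroup ⊓ Subgroup.centralizer ({(cmDatum L N H).toAdelic γ} : Set (cmDatum L N H).Adelic)).subgroupOf
        (Subgroup.centralizer ({(cmDatum L N H).toAdelic γ} : Set (cmDatum L N H).Adelic)))).IsHaarMeasure]
    (tA₀ : Measure ↥(Subgroup.centralizer ({(cmDatum L N H₀).toAdelic γ₀} : Set (cmDatum L N H₀).Adelic))) [IsHaarMeasure tA₀] [tA₀.IsMulRightInvariant]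
    [IsHaarMeasure (Measure.map (subgroupCongrHomeomorph E.toMulEquiv
          (Subgroup.centralizer ({(cmDatum L N H₀).toAdelic γ₀} : Set (cmDatum L N H₀).Adelic)) (Subgroup.centralizer ({(cmDatum L N H).toAdelic γ} : Set (cmDatum L N H).Adelic))
          (forall_apply_mem_centralizer_singleton_iff_of_eq E.toMulEquiv (congr_toAdelic_eq L g hg E hE γ₀ γ hγ))
          E.continuous E.symm.continuous) tA₀)]
    [(Measure.map (subgroupCongrHomeomorph E.toMulEquiv
          (Subgroup.centralizer ({(cmDatum L N H₀).toAdelic γ₀} : Set (cmDatum L N H₀).Adelic)) (Subgroup.centralizer ({(cmDatum L N H).toAdelic γ} : Set (cmDatum L N H).Adelic))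
          (forall_apply_mem_centralizer_singleton_iff_of_eq E.toMulEquiv (congr_toAdelic_eq L g hg E hE γ₀ γ hγ))
          E.continuous E.symm.continuous) tA₀).IsMulRightInvariant] :
    quotientMeasure (((cmDatum L N H₀).quotientSubgroup ⊓ Subgroup.centralizer ({(cmDatum L N H₀).toAdelic γ₀} : Set (cmDatum L N H₀).Adelic)).subgroupOf
        (Subgroup.centralizer ({(cmDatum L N H₀).toAdelic γ₀} : Set (cmDatum L N H₀).Adelic))) count
        (isClosed_subgroupOf _ _ ((isClosed_cmDatum_quotientSubgroup L N H₀).inter hZ₀)) tA₀ Set.univ =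
      quotientMeasure (((cmDatum L N H).quotientSubgroup ⊓ Subgroup.centralizer ({(cmDatum L N H).toAdelic γ} : Set (cmDatum L N H).Adelic)).subgroupOf
        (Subgroup.centralizer ({(cmDatum L N H).toAdelic γ} : Set (cmDatum L N H).Adelic))) count
        (isClosed_subgroupOf _ _ ((isClosed_cmDatum_quotientSubgroup L N H).inter hZ))
        (Measure.map (subgroupCongrHomeomorph E.toMulEquiv
          (Subgroup.centralizer ({(cmDatum L N H₀).toAdelic γ₀} : Set (cmDatum L N H₀).Adelic)) (Subgroup.centralizer ({(cmDatum L N H).toAdelic γ} : Set (cmDatum L N H).Adelic))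
          (forall_apply_mem_centralizer_singleton_iff_of_eq E.toMulEquiv (congr_toAdelic_eq L g hg E hE γ₀ γ hγ))
          E.continuous E.symm.continuous) tA₀) Set.univ := by
  -- topological and lattice-side instances (as in ★ (b2)′)
  haveI : LocallyCompactSpace ↥(Subgroup.centralizer ({(cmDatum L N H₀).toAdelic γ₀} : Set (cmDatum L N H₀).Adelic)) := hZ₀.isClosedEmbedding_subtypeVal.locallyCompactSpace
  haveI : LocallyCompactSpace ↥(Subgroup.centralizer ({(cmDatum L N H).toAdelic γ} : Set (cmDatum L N H).Adelic)) := hZ.isClosedEmbedding_subtypeVal.locallyCompactSpace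
  haveI hΓ₀ : IsClosed (((((cmDatum L N H₀).quotientSubgroup ⊓ (Subgroup.centralizer ({(cmDatum L N H₀).toAdelic γ₀} : Set (cmDatum L N H₀).Adelic))).subgroupOf (Subgroup.centralizer ({(cmDatum L N H₀).toAdelic γ₀} : Set (cmDatum L N H₀).Adelic))) : Subgroup ↥(Subgroup.centralizer ({(cmDatum L N H₀).toAdelic γ₀} : Set (cmDatum L N H₀).Adelic))) : Set ↥(Subgroup.centralizer ({(cmDatum L N H₀).toAdelic γ₀} : Set (cmDatum L N H₀).Adelic))) :=
    isClosed_subgroupOf _ _ ((isClosed_cmDatum_quotientSubgroup L N H₀).inter hZ₀)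
  haveI hΓ : IsClosed (((((cmDatum L N H).quotientSubgroup ⊓ (Subgroup.centralizer ({(cmDatum L N H).toAdelic γ} : Set (cmDatum L N H).Adelic))).subgroupOf (Subgroup.centralizer ({(cmDatum L N H).toAdelic γ} : Set (cmDatum L N H).Adelic))) : Subgroup ↥(Subgroup.centralizer ({(cmDatum L N H).toAdelic γ} : Set (cmDatum L N H).Adelic))) : Set ↥(Subgroup.centralizer ({(cmDatum L N H).toAdelic γ} : Set (cmDatum L N H).Adelic))) :=
    isClosed_subgroupOf _ _ ((isClosed_cmDatum_quotientSubgroup L N H).inter hZ)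
  haveI iC₀ := countable_quotientSubgroup_inf_centralizer_subgroupOf L N H₀ ((cmDatum L N H₀).toAdelic γ₀)
  haveI iC := countable_quotientSubgroup_inf_centralizer_subgroupOf L N H ((cmDatum L N H).toAdelic γ)
  haveI : MeasurableSingletonClass (cmDatum L N H₀).Adelic := inferInstance
  haveI : MeasurableSingletonClass (cmDatum L N H).Adelic := inferInstance
  haveI iMS₀ : MeasurableSingletonClass ↥(((cmDatum L N H₀).quotientSubgroup ⊓ (Subgroup.centralizer ({(cmDatum L N H₀).toAdelic γ₀} : Set (cmDatum L N H₀).Adelic))).subgroupOf (Subgroup.centralizer ({(cmDatum L N H₀).toAdelic γ₀} : Set (cmDatum L N H₀).Adelic))) := inferInstance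
  haveI iMS : MeasurableSingletonClass ↥(((cmDatum L N H).quotientSubgroup ⊓ (Subgroup.centralizer ({(cmDatum L N H).toAdelic γ} : Set (cmDatum L N H).Adelic))).subgroupOf (Subgroup.centralizer ({(cmDatum L N H).toAdelic γ} : Set (cmDatum L N H).Adelic))) := inferInstance
  haveI iSF₀ : SFinite (count : Measure ↥(((cmDatum L N H₀).quotientSubgroup ⊓ (Subgroup.centralizer ({(cmDatum L N H₀).toAdelic γ₀} : Set (cmDatum L N H₀).Adelic))).subgroupOf (Subgroup.centralizer ({(cmDatum L N H₀).toAdelic γ₀} : Set (cmDatum L N H₀).Adelic)))) := inferInstance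
  haveI iSF : SFinite (count : Measure ↥(((cmDatum L N H).quotientSubgroup ⊓ (Subgroup.centralizer ({(cmDatum L N H).toAdelic γ} : Set (cmDatum L N H).Adelic))).subgroupOf (Subgroup.centralizer ({(cmDatum L N H).toAdelic γ} : Set (cmDatum L N H).Adelic)))) := inferInstance
  -- `E|` as an isomorphism of groups `Z(γ₀ ⊗ 1) ≃* Z(γ ⊗ 1)` with the same underlying map as the homeomorphism
  let f : ↥(Subgroup.centralizer ({(cmDatum L N H₀).toAdelic γ₀} : Set (cmDatum L N H₀).Adelic)) ≃* ↥(Subgroup.centralizer ({(cmDatum L N H).toAdelic γ} : Set (cmDatum L N H).Adelic)) :=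
    { toEquiv := (subgroupCongrHomeomorph E.toMulEquiv (Subgroup.centralizer ({(cmDatum L N H₀).toAdelic γ₀} : Set (cmDatum L N H₀).Adelic)) (Subgroup.centralizer ({(cmDatum L N H).toAdelic γ} : Set (cmDatum L N H).Adelic)) (forall_apply_mem_centralizer_singleton_iff_of_eq E.toMulEquiv (congr_toAdelic_eq L g hg E hE γ₀ γ hγ)) E.continuous E.symm.continuous).toEquiv
      map_mul' := fun a b => Subtype.ext (map_mul E.toMulEquiv (a : (cmDatum L N H₀).Adelic) (b : (cmDatum L N H₀).Adelic)) }
  have hf : (f : ↥(Subgroup.centralizer ({(cmDatum L N H₀).toAdelic γ₀} : Set (cmDatum L N H₀).Adelic)) → ↥(Subgroup.centralizer ({(cmDatum L N H).toAdelic γ} : Set (cmDatum L N H).Adelic))) = (subgroupCongrHomeomorph E.toMulEquiv (Subgroup.centralizer ({(cmDatum L N H₀).toAdelic γ₀} : Set (cmDatum L N H₀).Adelic)) (Subgroup.centralizer ({(cmDatum L N H).toAdelic γ} : Set (cmDatum L N H).Adelic)) (forall_apply_mem_centralizer_singleton_iff_of_eq E.toMulEquiv (congr_toAdelic_eq L g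 hg E hE γ₀ γ hγ)) E.continuous E.symm.continuous) := rfl
  have hfs : (f.symm : ↥(Subgroup.centralizer ({(cmDatum L N H).toAdelic γ} : Set (cmDatum L N H).Adelic)) → ↥(Subgroup.centralizer ({(cmDatum L N H₀).toAdelic γ₀} : Set (cmDatum L N H₀).Adelic))) = (subgroupCongrHomeomorph E.toMulEquiv (Subgroup.centralizer ({(cmDatum L N H₀).toAdelic γ₀} : Set (cmDatum L N H₀).Adelic)) (Subgroup.centralizer ({(cmDatum L N H).toAdelic γ} : Set (cmDatum L N H).Adelic)) (forall_apply_mem_centralizer_singleton_iff_of_eq E.toMulEquiv (congr_toAdelic_eq L g hg E hE γ₀ γ hγ)) E.continuous E.symm.continuous).symm := rfl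
  have hfc : Continuous f := hf ▸ (subgroupCongrHomeomorph E.toMulEquiv (Subgroup.centralizer ({(cmDatum L N H₀).toAdelic γ₀} : Set (cmDatum L N H₀).Adelic)) (Subgroup.centralizer ({(cmDatum L N H).toAdelic γ} : Set (cmDatum L N H).Adelic)) (forall_apply_mem_centralizer_singleton_iff_of_eq E.toMulEquiv (congr_toAdelic_eq L g hg E hE γ₀ γ hγ)) E.continuous E.symm.continuous).continuous
  have hfsc : Continuous f.symm := hfs ▸ (subgroupCongrHomeomorph E.toMulEquiv (Subgroup.centralizer ({(cmDatum L N H₀).toAdelic γ₀} : Set (cmDatum L N H₀).Adelic)) (Subgroup.centralizer ({(cmDatum L N H).toAdelic γ} : Set (cmDatum L N H).Adelic)) (forall_apply_mem_centralizer_singleton_iff_of_eq E.toMulEquiv (congr_toAdelic_eq L g hg E hE γ₀ γ hγ)) E.continuous E.symm.continuous).symm.continuous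
  have hν : Measure.map f tA₀ = Measure.map (subgroupCongrHomeomorph E.toMulEquiv (Subgroup.centralizer ({(cmDatum L N H₀).toAdelic γ₀} : Set (cmDatum L N H₀).Adelic)) (Subgroup.centralizer ({(cmDatum L N H).toAdelic γ} : Set (cmDatum L N H).Adelic)) (forall_apply_mem_centralizer_singleton_iff_of_eq E.toMulEquiv (congr_toAdelic_eq L g hg E hE γ₀ γ hγ)) E.continuous E.symm.continuous) tA₀ := by rw [hf]
  -- the lattice goes to the lattice
  have hΓΓ : ∀ z : ↥(Subgroup.centralizer ({(cmDatum L N H₀).toAdelic γ₀} : Set (cmDatum L N H₀).Adelic)), f z ∈ (((cmDatum L N H).quotientSubgroup ⊓ (Subgroup.centralizer ({(cmDatum L N H).toAdelic γ} : Set (cmDatum L N H).Adelic))).subgroupOf (Subgroup.centralizer ({(cmDatum L N H).toAdelic γ} : Set (cmDatum L N H).Adelic))) ↔ z ∈ (((cmDatum L N H₀).quotientSubgroup ⊓ (Subgroup.centralizer ({(cmDatum L N H₀).toAdelic γ₀} : Set (cmDatum L N H₀).Adelic))).subgroupOf (Subgroup.centralizer ({(cmDatum L N H₀).toAdelic γ₀}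 : Set (cmDatum L N H₀).Adelic))) := by
    intro z
    rw [Subgroup.mem_subgroupOf, Subgroup.mem_subgroupOf, Subgroup.mem_inf, Subgroup.mem_inf]
    change (E (z : (cmDatum L N H₀).Adelic) ∈ (cmDatum L N H).quotientSubgroup ∧ (E (z : (cmDatum L N H₀).Adelic)) ∈ (Subgroup.centralizer ({(cmDatum L N H).toAdelic γ} : Set (cmDatum L N H).Adelic))) ↔ _
    rw [congr_mem_quotientSubgroup_iff L g hg E hE]
    exact ⟨fun h => ⟨h.1, z.2⟩, fun h => ⟨h.1, ((subgroupCongrHomeomorph E.toMulEquiv (Subgroup.centralizer ({(cmDatum L N H₀).toAdelic γ₀} : Set (cmDatum L N H₀).Adelic)) (Subgroup.centralizer ({(cmDatum L N H).toAdelic γ} : Set (cmDatum L N H).Adelic)) (forall_apply_mem_centralizer_singleton_iff_of_eq E.toMulEquiv (congr_toAdelic_eq L g hg E hE γ₀ γ hγ)) E.continuous E.symm.continuous) z).2⟩⟩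
  exact covolume_count_eq_of_mulEquiv' f hfc hfsc (((cmDatum L N H₀).quotientSubgroup ⊓ (Subgroup.centralizer ({(cmDatum L N H₀).toAdelic γ₀} : Set (cmDatum L N H₀).Adelic))).subgroupOf (Subgroup.centralizer ({(cmDatum L N H₀).toAdelic γ₀} : Set (cmDatum L N H₀).Adelic))) (((cmDatum L N H).quotientSubgroup ⊓ (Subgroup.centralizer ({(cmDatum L N H).toAdelic γ} : Set (cmDatum L N H).Adelic))).subgroupOf (Subgroup.centralizer ({(cmDatum L N H).toAdelic γ} : Set (cmDatum L N H).Adelic))) hΓΓ tA₀ (Measure.map (subgroupCongrHomeomorph E.toMulEquiv (Subgroup.centralizer ({(cmDatum L N H₀).toAdelic γ₀} : Set (cmDatum L N H₀).Adelic)) (Subgroup.centralizer ({(cmDatum L N H).toAdelic γ} : Set (cmDatum L N H).Adelic)) (forall_apply_mem_centralizer_singleton_iff_of_eq E.toMulEquiv (congr_toAdelic_eq L g hg E hE γ₀ γ hγ)) E.continuous E.symm.continuous) tA₀) hν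

end Tower

end UnitaryGroup

end Literature.NumberTheory.Automorphic

end
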